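import Literature.AlgebraicGeometry.Motives.LinesGenerateChowOneRationalChains
import Literature.RingTheory.MvPolynomial.LineChainConnectivity

/-!
# `CH₁(X) ⊗ ℚ` is generated by lines for every `X = V₊(F₁, …, F_c) ⊆ ℙᴺ` with `Σ deg Fₐ ≤ N - 1`

The first step of the proof of Tian–Zong's Theorem 6.1 (= Thm. 1.7; Compositio Math. 150 (2014),
§6: "By the assumption, `X` is rationally chain connected by chains of lines (Lemma 4.8.1, Chap. V
of [Kollár]). … `CH₀(F(X)) ⊗ ℚ → CH₁(X) ⊗ ℚ` is surjective (Proposition 3.13.3, Chap. IV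
[Kollár])"), made unconditional for the whole range `Σₐ dₐ ≤ N - 1` of the theorem: for a closed
subscheme `X ⊆ ℙᴺ_k` (`k` algebraically closed) with underlying set `V₊(F₁, …, F_c)`, `Fₐ` forms
of degrees `dₐ ≥ 1` with `Σₐ dₐ + 1 ≤ N`, **every class in `CH₁(X)` has a positive multiple in the
subgroup generated by the classes of the lines of `X`**, i.e. `CH₁(X)/⟨lines⟩` is a torsion group
(`isTorsion_chowGroupOne_quot_lineClasses_of_sum_deg_le`). The two inputs are the tree's

* `Literature.AlgebraicGeometry.Motives.isTorsion_chowGroupOne_quot_lineClasses_of_chain`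
  (`Motives/LinesGenerateChowOneRationalChains`: the product trick of Tian–Zong Prop. 7.1 along a
  chain of lines joining the generic point of a curve to a constant point — Kollár IV.3.13.3 in
  this setting), whose hypothesis `hchain` is
* `Literature.RingTheory.MvPolynomial.exists_chain_of_sum_deg_le`
  (`RingTheory/MvPolynomial/LineChainConnectivity`: chain connectedness by lines of `V₊(F)` over
  algebraically closed fields when `Σ dₐ ≤ N - 1` — Kollár V.4.8.1 — from the multihomogeneous
  Bézout existence theorem).

Previously the tree had this for `Σₐ (2dₐ - 1) ≤ N` (chains of two lines,
`Motives/LinesGenerateChowOneRational`), for cubic hypersurfaces (`N ≥ 4`) and for intersections of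
two quadrics (`N ≥ 5`); new cases include quartic hypersurfaces in `ℙ⁵, ℙ⁶`, `(2,3) ⊆ ℙ⁶, ℙ⁷`,
`(2,2,2) ⊆ ℙ⁷, ℙ⁸`, `(3,3) ⊆ ℙ⁷, ℙ⁸, ℙ⁹`. In the binders of the named fact
`Literature.AlgebraicGeometry.Motives.TianZong2014_chowOne_generatedByLines` (smooth complete
intersections of type `d` in `ℙⁿ⁺ᶜ`, `Σ dₐ + 1 ≤ n + c`, characteristic `0`) this is
`TianZong2014_chowOne_generatedByLines_upToTorsion`: the fact holds up to torsion (what remains of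
Thm. 6.1 is the integral step, Tian–Zong §§3, 5, 6: Jacobian divisibility of `CH₁(X)_alg`, curves
algebraically equivalent to sums of rational curves via stable maps, rational curves to sums of
lines via Hartshorne's connectedness). Everything here is proved; no definitions, no named facts.

## References

* Z. Tian, H. R. Zong, *One-cycles on rationally connected varieties*, Compositio Math. 150
  (2014), 396–408, Thm. 1.7, proof of Thm. 6.1 (first two sentences), Prop. 7.1. [TianZong2014]
* J. Kollár, *Rational Curves on Algebraic Varieties*, Springer 1996, IV.3.13.3, V.4.8.1.
-/

noncomputable section

open CategoryTheory AlgebraicGeometry MvPolynomial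

universe u

namespace Literature.AlgebraicGeometry.Motives

attribute [local instance] MvPolynomial.gradedAlgebra

variable {k : Type u} [Field k] [IsAlgClosed k]

/-- **`CH₁(X) ⊗ ℚ` is generated by lines when `Σ deg Fₐ ≤ N - 1`**: for `X ⊆ ℙᴺ_k` (`k`
algebraically closed) a closed subscheme with underlying set `V₊(F₁, …, F_c)`, `Fₐ` forms of
degrees `dₐ ≥ 1` with `Σₐ dₐ + 1 ≤ N`, every `x ∈ CH₁(X)` has a positive multiple in the subgroup
generated by the line classes. Chains of lines over algebraically closed fields
(`Literature.RingTheory.MvPolynomial.exists_chain_of_sum_deg_le`, Kollár V.4.8.1) feed the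
product trick `exists_pos_smul_mem_closure_lineClasses_of_chain` (Kollár IV.3.13.3).
[cite: TianZong2014, proof of Thm. 6.1, Prop. 7.1] -/
theorem exists_pos_smul_mem_closure_lineClasses_of_sum_deg_le {N : ℕ} {X : SchemeOver k}
    {c : ℕ} (F : Fin c → MvPolynomial (Fin (N + 1)) k) (d : Fin c → ℕ)
    (i : X ⟶ projectiveSpace N k) [IsClosedImmersion i.left]
    (hFhom : ∀ a, (F a).IsHomogeneous (d a)) (hd : ∀ a, 0 < d a) (hN : ∑ a, d a + 1 ≤ N)
    (hrange : Set.range i.left.base =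
      ProjectiveSpectrum.zeroLocus (homogeneousSubmodule (Fin (N + 1)) k) (Set.range F))
    (x : ChowGroup X.left 1) :
    ∃ e : ℕ, 0 < e ∧ (e : ℤ) • x ∈ AddSubgroup.closure (lineClasses N i) :=
  exists_pos_smul_mem_closure_lineClasses_of_chain (by omega) F d i hFhom hd hrange
    (fun L _ _ _ p q hp0 hq0 hp hq =>
      Literature.RingTheory.MvPolynomial.exists_chain_of_sum_deg_le
        (fun a => (hFhom a).map _) hd hN p q hp0 hq0 hp hq) x

/-- Quotient form: **`CH₁(X)/⟨lines⟩` is a torsion group** for every closed `X ⊆ ℙᴺ_k` with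
underlying set `V₊(F₁, …, F_c)`, `Σₐ deg Fₐ + 1 ≤ N` (`k` algebraically closed) — the first step
of the proof of Tian–Zong's Thm. 6.1, for the whole range of the theorem.
[cite: TianZong2014, proof of Thm. 6.1, Prop. 7.1] -/
theorem isTorsion_chowGroupOne_quot_lineClasses_of_sum_deg_le {N : ℕ} {X : SchemeOver k}
    {c : ℕ} (F : Fin c → MvPolynomial (Fin (N + 1)) k) (d : Fin c → ℕ)
    (i : X ⟶ projectiveSpace N k) [IsClosedImmersion i.left]
    (hFhom : ∀ a, (F a).IsHomogeneous (d a)) (hd : ∀ a, 0 < d a) (hN : ∑ a, d a + 1 ≤ N)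
    (hrange : Set.range i.left.base =
      ProjectiveSpectrum.zeroLocus (homogeneousSubmodule (Fin (N + 1)) k) (Set.range F)) :
    AddMonoid.IsTorsion (ChowGroup X.left 1 ⧸ AddSubgroup.closure (lineClasses N i)) :=
  isTorsion_chowGroupOne_quot_lineClasses_of_chain (by omega) F d i hFhom hd hrange
    (fun L _ _ _ p q hp0 hq0 hp hq =>
      Literature.RingTheory.MvPolynomial.exists_chain_of_sum_deg_le
        (fun a => (hFhom a).map _) hd hN p q hp0 hq0 hp hq)

/-- **Tian–Zong's Theorem 1.7 up to torsion, in the binders of the named fact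
`TianZong2014_chowOne_generatedByLines`.** For a smooth complete intersection `X ⊆ ℙⁿ⁺ᶜ_k` of
type `d` (forms `F` with the Jacobian condition, `i : X ↪ ℙⁿ⁺ᶜ` a closed immersion onto `V₊(F)`)
over an algebraically closed field of characteristic `0` with `Σ dₐ + 1 ≤ n + c`, the quotient of
`CH₁(X)` by the subgroup generated by the line classes is a torsion group (equivalently
`CH₁(X) ⊗ ℚ` is generated by lines). The fact's remaining hypotheses (`IsSmoothProjective n X`,
the Jacobian condition `IsNonsingularSystem k F`, `CharZero k`) are not needed and omitted. What the
fact asserts beyond this is that the quotient is zero.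
[cite: TianZong2014, Thm. 1.7, proof of Thm. 6.1 (first step)] -/
theorem TianZong2014_chowOne_generatedByLines_upToTorsion {k : Type u} [Field k] [IsAlgClosed k]
    {c : ℕ} (n : ℕ) (d : Fin c → ℕ) {X : SchemeOver k}
    (F : Fin c → MvPolynomial (Fin (n + c + 1)) k) (i : X ⟶ projectiveSpace (n + c) k)
    (hF : ∀ a, (F a).IsHomogeneous (d a)) (hd : ∀ a, 0 < d a) [IsClosedImmersion i.left]
    (hV : Set.range i.left.base =
      ProjectiveSpectrum.zeroLocus (MvPolynomial.homogeneousSubmodule (Fin (n + c + 1)) k)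
        (Set.range F))
    (hdeg : (∑ a, d a) + 1 ≤ n + c) :
    AddMonoid.IsTorsion (ChowGroup X.left 1 ⧸ AddSubgroup.closure (lineClasses (n + c) i)) :=
  isTorsion_chowGroupOne_quot_lineClasses_of_sum_deg_le F d i hF hd hdeg hV

end Literature.AlgebraicGeometry.Motives

end
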